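import Summits.FinalStateConjecture.FinalStateConjecture.Theorems.SwallowTheDatumUniversalWitnessFamilyStubSchwOutSiteAux1
import Mathlib.MeasureTheory.Constructions.HaarToSphere
import Mathlib.MeasureTheory.Measure.Lebesgue.VolumeOfBalls
import Mathlib.MeasureTheory.Measure.Haar.NormedSpace
import Mathlib.MeasureTheory.Measure.Haar.Unique
import Mathlib.MeasureTheory.Group.Integral
import Mathlib.Analysis.Real.Pi.Bounds
import HarnessLib

/-!
# Stub `stub_schwOutSite` of the line `Sketch` (crux `SwallowTheDatum.UniversalWitnessFamily`,
# item stmt-FinalStateConjecture-10051) — helper file 2: OUT-charges and OUT-deviation of a Schwarzschild datum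

For coefficient fields `(g, k)` on `ℝ³` which are EXACTLY `((1 + m/2‖y‖)⁴ δ, 0)` off the ball of radius `1/4`
(the fields `S.coordH, S.coordK` of any `S` with the engine's `SchwDatum m S`; the Schwarzschild field is written
out, as in helper file 1), the Mao–Oh–Tao averaged charges read on `A_32 = {32 < ‖x‖ < 64}`
(`Literature/Geometry/Lorentzian/ObstructionFreeGluing.lean`, (1.3)–(1.7)) are

* `avgP η 32 k i = 0`, `avgJ η 32 k l = 0` — the integrand vanishes identically (`k = 0` where the weight
  `η_32` lives);
* `avgC η 32 g l = 0` — the integrand is `x_l ·` (radial) (helper file 1, `sumC_eq`), odd, and Lebesgue measure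
  on `ℝ³` is invariant under `x ↦ −x` (`integral_neg_eq_self`);
* `avgE η 32 g = (π m/4) ∫ η(r/32)(1 + m/(2r))³ dr` (radial integration, `integral_fun_norm_addHaar`,
  `vol B₁ = 4π/3` from `EuclideanSpace.volume_ball_fin_three`), and `|∫ η(r/32)(1 + m/(2r))³ dr − 32| ≤ 2 m ∫|η|`
  for `0 ≤ m ≤ 1`, whence `12 m ≤ avgE η 32 g ≤ 48 m` once `m ∫|η| ≤ 8`;

and the `C² × C¹` deviation `DevLE g k 32 64 (c·m)` holds with the absolute constant of helper file 1
(`exists_devBound`; the iterated derivatives only see germs, `Filter.EventuallyEq.iteratedFDeriv`).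

References: Mao–Oh–Tao arXiv:2308.13031 §1.2, Rem 1.11; the crux directory's `PICKED.md`.
-/

-- `Summit.<Summit>.<Problem>` is the tree's mandated summit-side namespace (CONVENTIONS §2); for this
-- single-conjunct summit the two coincide, so the duplicate is deliberate.
set_option linter.dupNamespace false

noncomputable section

-- instance search through the nested operator types `E3 →L E3 →L ℝ`
set_option maxSynthPendingDepth 3

namespace Summit.FinalStateConjecture.FinalStateConjecture.Theorems.SwallowTheDatum.UniversalWitnessFamily

open scoped ContDiff Topology BigOperators InnerProductSpace
open Set Filter Function MeasureTheory Literature.Geometry.Lorentzian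
open Literature.Geometry.Lorentzian.MaoOhTao

variable {η : ℝ → ℝ} {m : ℝ} {g k : E3 → E3 →L[ℝ] E3 →L[ℝ] ℝ}

/-! ## §1 Germs on the exterior of the ball of radius `1/4`; the weight `η_32` -/

/-- A field that is Schwarzschild off `B_{1/4}` has the Schwarzschild germ at every exterior point. [folklore] -/
theorem eventuallyEq_schw
    (hg : ∀ y : E3, 1 / 4 < ‖y‖ → g y = (1 + m / (2 * ‖y‖)) ^ 4 • (innerSL ℝ : E3 →L[ℝ] E3 →L[ℝ] ℝ))
    {x : E3} (hx : 1 / 4 < ‖x‖) :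
    g =ᶠ[𝓝 x] fun y : E3 ↦ (1 + m / (2 * ‖y‖)) ^ 4 • (innerSL ℝ : E3 →L[ℝ] E3 →L[ℝ] ℝ) :=
  Filter.eventually_of_mem ((isOpen_lt continuous_const continuous_norm).mem_nhds hx) fun y hy ↦ hg y hy

/-- A field that vanishes off `B_{1/4}` has the zero germ at every exterior point. [folklore] -/
theorem schwOut_eventuallyEq_zero (hk : ∀ y : E3, 1 / 4 < ‖y‖ → k y = 0) {x : E3} (hx : 1 / 4 < ‖x‖) :
    k =ᶠ[𝓝 x] fun _ ↦ 0 :=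
  Filter.eventually_of_mem ((isOpen_lt continuous_const continuous_norm).mem_nhds hx) fun y hy ↦ hk y hy

/-- The weight `η_32` vanishes on the closed ball of radius `32`. [folklore] -/
theorem wt32_eq_zero_of_le (hη : IsBump η) {x : E3} (hx : ‖x‖ ≤ 32) : wt η 32 x = 0 := by
  have : ‖x‖ / 32 ≤ 1 := by rw [div_le_one (by norm_num)]; exact hx
  simp [wt, hη.2.1 _ this]

/-- Off the closed ball of radius `32` a point is exterior to `B_{1/4}` and nonzero. [folklore] -/
theorem schwOut_quarter_lt {x : E3} (hx : ¬ ‖x‖ ≤ 32) : 1 / 4 < ‖x‖ ∧ x ≠ 0 := by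
  have h := not_le.1 hx
  exact ⟨by linarith, norm_pos_iff.1 (by linarith)⟩

/-! ## §2 The momentum and angular-momentum charges vanish -/

/-- **`P_out = 0`**: the averaged linear momentum on `A_32` of a field vanishing off `B_{1/4}` is `0`. [folklore] -/
theorem avgP32_eq_zero (hη : IsBump η) (hk : ∀ y : E3, 1 / 4 < ‖y‖ → k y = 0) (i : Fin 3) :
    avgP η 32 k i = 0 := by
  unfold avgP
  have h0 : ∀ x : E3, wt η 32 x * ∑ j, (cmp k i j x - (if i = j then trδ k x else 0)) * (x j / ‖x‖) = 0 := by
    intro x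
    by_cases hx : ‖x‖ ≤ 32
    · rw [wt32_eq_zero_of_le hη hx, zero_mul]
    · have hx' := (schwOut_quarter_lt hx).1
      have hk0 : ∀ a b, cmp k a b x = 0 := fun a b ↦ by simp [MaoOhTao.cmp, hk x hx']
      have ht : trδ k x = 0 := by simp [trδ, hk0]
      simp [hk0, ht]
  simp only [h0, integral_zero]

/-- **`J_out = 0`**: the averaged angular momentum on `A_32` of a field vanishing off `B_{1/4}` is `0`. [folklore] -/
theorem avgJ32_eq_zero (hη : IsBump η) (hk : ∀ y : E3, 1 / 4 < ‖y‖ → k y = 0) (l : Fin 3) :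
    avgJ η 32 k l = 0 := by
  unfold avgJ
  have h0 : ∀ x : E3, wt η 32 x * ∑ i, ∑ j,
      (cmp k i j x - (if i = j then trδ k x else 0)) * rotGen l x i * (x j / ‖x‖) = 0 := by
    intro x
    by_cases hx : ‖x‖ ≤ 32
    · rw [wt32_eq_zero_of_le hη hx, zero_mul]
    · have hx' := (schwOut_quarter_lt hx).1
      have hk0 : ∀ a b, cmp k a b x = 0 := fun a b ↦ by simp [MaoOhTao.cmp, hk x hx']
      have ht : trδ k x = 0 := by simp [trδ, hk0]
      simp [hk0, ht]
  simp only [h0, integral_zero]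

/-! ## §3 The centre-of-mass charge vanishes (oddness) -/

/-- **`C_out = 0`**: the averaged centre of mass on `A_32` of a field which is Schwarzschild off `B_{1/4}` is `0` —
the integrand is `x_l` times a radial function, and Lebesgue measure is invariant under `x ↦ −x`. [folklore] -/
theorem avgC32_eq_zero (hη : IsBump η)
    (hg : ∀ y : E3, 1 / 4 < ‖y‖ → g y = (1 + m / (2 * ‖y‖)) ^ 4 • (innerSL ℝ : E3 →L[ℝ] E3 →L[ℝ] ℝ))
    (l : Fin 3) : avgC η 32 g l = 0 := by
  unfold avgC
  set I : E3 → ℝ := fun x ↦ wt η 32 x * ∑ i, ∑ j,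
    (x l * pd i (cmp g i j) x - x l * pd j (cmp g i i) x
      - (if i = l then cmp g i j x - (if i = j then 1 else 0) else 0)
      + (if j = l then cmp g i i x - 1 else 0)) * (x j / ‖x‖) with hI_def
  have hI : ∀ x : E3, I x = x l * (wt η 32 x *
      (4 * m * (1 + m / (2 * ‖x‖)) ^ 3 / ‖x‖ ^ 2 + 2 * ((1 + m / (2 * ‖x‖)) ^ 4 - 1) / ‖x‖)) := by
    intro x
    by_cases hx : ‖x‖ ≤ 32
    · simp only [hI_def, wt32_eq_zero_of_le hη hx, zero_mul, mul_zero]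
    · obtain ⟨hx', hx0⟩ := schwOut_quarter_lt hx
      simp only [hI_def]
      rw [sumC_eq (eventuallyEq_schw hg hx') hx0 l]
      ring
  have hwt : ∀ x : E3, wt η 32 (-x) = wt η 32 x := fun x ↦ by simp [wt, norm_neg]
  have hodd : ∀ x : E3, I (-x) = -I x := fun x ↦ by
    rw [hI, hI, hwt, norm_neg, PiLp.neg_apply, neg_mul]
  have hint : ∫ x, I x = 0 := by
    have h1 : ∫ x, I (-x) = ∫ x, I x := integral_neg_eq_self I volume
    simp only [hodd, integral_neg] at h1
    linarith
  change 1 / 2 * ∫ x, I x = 0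
  rw [hint, mul_zero]

/-! ## §4 The energy charge -/

/-- **`E_out` in closed form**: the averaged energy on `A_32` of a field which is Schwarzschild off `B_{1/4}`
is `(π m/4) ∫ η(r/32)(1 + m/(2r))³ dr` (radial integration of `η_32(|x|) · 4m(1 + m/2|x|)³/|x|²`). [folklore] -/
theorem avgE32_eq (hη : IsBump η)
    (hg : ∀ y : E3, 1 / 4 < ‖y‖ → g y = (1 + m / (2 * ‖y‖)) ^ 4 • (innerSL ℝ : E3 →L[ℝ] E3 →L[ℝ] ℝ)) :
    avgE η 32 g = Real.pi * m / 4 * ∫ r, η (r / 32) * (1 + m / (2 * r)) ^ 3 := by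
  unfold avgE
  set F : ℝ → ℝ := fun r ↦ 32⁻¹ * η (r / 32) * (4 * m * (1 + m / (2 * r)) ^ 3 / r ^ 2) with hF_def
  have hI : (fun x : E3 ↦ wt η 32 x * ∑ i, ∑ j, (pd i (cmp g i j) x - pd j (cmp g i i) x) * (x j / ‖x‖)) =
      fun x ↦ F ‖x‖ := by
    funext x
    change wt η 32 x * _ = wt η 32 x * _
    by_cases hx : ‖x‖ ≤ 32
    · rw [wt32_eq_zero_of_le hη hx, zero_mul, zero_mul]
    · obtain ⟨hx', hx0⟩ := schwOut_quarter_lt hx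
      rw [sumE_eq (eventuallyEq_schw hg hx') hx0]
  have hrad : ∫ x : E3, F ‖x‖ = 3 • ((volume : Measure E3).real (Metric.ball 0 1) •
      ∫ y in Ioi (0 : ℝ), y ^ 2 • F y) := by
    simpa [finrank_euclideanSpace_fin] using integral_fun_norm_addHaar (volume : Measure E3) F
  have hset : ∫ y in Ioi (0 : ℝ), y ^ 2 • F y = m / 8 * ∫ r, η (r / 32) * (1 + m / (2 * r)) ^ 3 := by
    have h3 : EqOn (fun y : ℝ ↦ y ^ 2 • F y) (fun r ↦ m / 8 * (η (r / 32) * (1 + m / (2 * r)) ^ 3)) (Ioi 0) := by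
      intro r hr
      have hr0 : r ≠ 0 := (ne_of_gt hr)
      simp only [hF_def, smul_eq_mul]
      field_simp
      ring
    rw [setIntegral_congr_fun measurableSet_Ioi h3, integral_const_mul]
    congr 1
    apply setIntegral_eq_integral_of_forall_compl_eq_zero
    intro r hr
    have hr' : r ≤ 0 := not_lt.1 hr
    simp [hη.2.1 (r / 32) (by linarith)]
  have hvol : (volume : Measure E3).real (Metric.ball 0 1) = 4 * Real.pi / 3 := by
    rw [Measure.real, EuclideanSpace.volume_ball_fin_three, ENNReal.toReal_mul, ENNReal.ofReal_one, one_pow,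
      ENNReal.toReal_one, ENNReal.toReal_ofReal (by positivity)]
    ring
  rw [hI, hrad, hset, hvol]
  simp only [smul_eq_mul, nsmul_eq_mul, Nat.cast_ofNat]
  ring

/-- The support of a bump lies in `[1, 2]`; a bump is integrable. [folklore] -/
theorem schwOut_integrable_bump (hη : IsBump η) : Integrable η := by
  have hsupp : Function.support η ⊆ Set.Icc 1 2 := by
    intro s hs
    rw [Function.mem_support] at hs
    by_contra h
    rw [Set.mem_Icc, not_and_or, not_le, not_le] at h
    rcases h with h | h
    · exact hs (hη.2.1 s h.le)
    · exact hs (hη.2.2.1 s h.le)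
  exact hη.1.continuous.integrable_of_hasCompactSupport
    (HasCompactSupport.of_support_subset_isCompact isCompact_Icc hsupp)

/-- Where `η(r/32) ≠ 0` the radius lies in `(32, 64)`. [folklore] -/
theorem schwOut_mem_Ioo_of_ne_zero (hη : IsBump η) {r : ℝ} (hr : η (r / 32) ≠ 0) : 32 < r ∧ r < 64 := by
  constructor
  · by_contra h
    exact hr (hη.2.1 _ (by rw [div_le_one (by norm_num)]; linarith))
  · by_contra h
    exact hr (hη.2.2.1 _ (by rw [le_div_iff₀ (by norm_num)]; linarith))

/-- **The radial energy integral is close to `32`**: `|∫ η(r/32)(1 + m/(2r))³ dr − 32| ≤ 2 m ∫|η|` for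
`0 ≤ m ≤ 1` (`∫ η(r/32) dr = 32 ∫ η = 32`, and `0 ≤ (1 + m/(2r))³ − 1 ≤ m/16` on the support `32 < r < 64`).
[folklore] -/
theorem abs_profileIntegral_sub_le (hη : IsBump η) (hm0 : 0 ≤ m) (hm1 : m ≤ 1) :
    |(∫ r, η (r / 32) * (1 + m / (2 * r)) ^ 3) - 32| ≤ 2 * m * ∫ s, |η s| := by
  have hηi := schwOut_integrable_bump hη
  have h32 : Integrable (fun r ↦ η (r / 32)) := hηi.comp_div (by norm_num)
  -- elementary bounds on the profile on the support
  have hprof : ∀ r : ℝ, η (r / 32) ≠ 0 →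
      0 ≤ (1 + m / (2 * r)) ^ 3 - 1 ∧ (1 + m / (2 * r)) ^ 3 - 1 ≤ m / 16 := by
    intro r hr
    obtain ⟨h1, h2⟩ := schwOut_mem_Ioo_of_ne_zero hη hr
    set a : ℝ := m / (2 * r) with ha_def
    have ha0 : 0 ≤ a := by positivity
    have ha1 : a ≤ m / 64 := by
      rw [ha_def]
      exact div_le_div_of_nonneg_left hm0 (by norm_num) (by linarith)
    have ha2 : a ≤ 1 / 64 := ha1.trans (by linarith)
    refine ⟨by nlinarith [mul_nonneg ha0 ha0, mul_nonneg (mul_nonneg ha0 ha0) ha0], ?_⟩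
    have : (1 + a) ^ 3 - 1 ≤ 4 * a := by nlinarith [mul_nonneg ha0 ha0, mul_nonneg (mul_nonneg ha0 ha0) ha0]
    linarith
  have hbd : ∀ r : ℝ, ‖η (r / 32) * (1 + m / (2 * r)) ^ 3‖ ≤ 2 * |η (r / 32)| := by
    intro r
    by_cases hr : η (r / 32) = 0
    · simp [hr]
    · obtain ⟨h1, h2⟩ := hprof r hr
      rw [norm_mul, Real.norm_eq_abs, Real.norm_eq_abs,
        abs_of_nonneg (show (0 : ℝ) ≤ (1 + m / (2 * r)) ^ 3 by linarith), mul_comm]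
      exact mul_le_mul_of_nonneg_right (by linarith) (abs_nonneg _)
  have hmeas : AEStronglyMeasurable (fun r : ℝ ↦ η (r / 32) * (1 + m / (2 * r)) ^ 3) volume := by
    refine h32.aestronglyMeasurable.mul ?_
    exact (Measurable.pow_const ((measurable_const.div (measurable_const.mul measurable_id)).const_add 1) 3)
      |>.aestronglyMeasurable
  have hint : Integrable (fun r ↦ η (r / 32) * (1 + m / (2 * r)) ^ 3) :=
    Integrable.mono' (h32.abs.const_mul 2) hmeas (ae_of_all _ hbd)
  have hI32 : ∫ r, η (r / 32) = 32 := by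
    rw [Measure.integral_comp_div (fun s ↦ η s) 32, hη.2.2.2]
    norm_num
  have hdiff : (∫ r, η (r / 32) * (1 + m / (2 * r)) ^ 3) - 32 =
      ∫ r, η (r / 32) * ((1 + m / (2 * r)) ^ 3 - 1) := by
    calc (∫ r, η (r / 32) * (1 + m / (2 * r)) ^ 3) - 32
        = (∫ r, η (r / 32) * (1 + m / (2 * r)) ^ 3) - ∫ r, η (r / 32) := by rw [hI32]
      _ = ∫ r, (η (r / 32) * (1 + m / (2 * r)) ^ 3 - η (r / 32)) := (integral_sub hint h32).symm
      _ = ∫ r, η (r / 32) * ((1 + m / (2 * r)) ^ 3 - 1) := by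
          congr 1
          funext r
          ring
  rw [hdiff]
  have hbd2 : ∀ r : ℝ, ‖η (r / 32) * ((1 + m / (2 * r)) ^ 3 - 1)‖ ≤ m / 16 * |η (r / 32)| := by
    intro r
    by_cases hr : η (r / 32) = 0
    · simp [hr]
    · obtain ⟨h1, h2⟩ := hprof r hr
      rw [norm_mul, Real.norm_eq_abs, Real.norm_eq_abs, abs_of_nonneg h1, mul_comm]
      exact mul_le_mul_of_nonneg_right h2 (abs_nonneg _)
  calc |∫ r, η (r / 32) * ((1 + m / (2 * r)) ^ 3 - 1)|
      = ‖∫ r, η (r / 32) * ((1 + m / (2 * r)) ^ 3 - 1)‖ := (Real.norm_eq_abs _).symm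
    _ ≤ ∫ r, m / 16 * |η (r / 32)| := norm_integral_le_of_norm_le (h32.abs.const_mul _) (ae_of_all _ hbd2)
    _ = m / 16 * (32 * ∫ s, |η s|) := by
        rw [integral_const_mul, Measure.integral_comp_div (fun s ↦ |η s|) 32]
        norm_num
    _ = 2 * m * ∫ s, |η s| := by ring

/-- `∫|η| ≥ 1` for a bump (`∫ η = 1`). [folklore] -/
theorem schwOut_one_le_integral_abs (hη : IsBump η) : 1 ≤ ∫ s, |η s| := by
  have h := abs_integral_le_integral_abs (f := η) (μ := volume)
  rw [hη.2.2.2, abs_one] at h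
  exact h

/-- **`E_out` is between `12 m` and `48 m`** for a field which is Schwarzschild(`m`) off `B_{1/4}`, once
`0 < m ≤ 1` and `m ∫|η| ≤ 8` (then `E_out ∈ [4πm, 12πm]`). [folklore] -/
theorem avgE32_bounds (hη : IsBump η)
    (hg : ∀ y : E3, 1 / 4 < ‖y‖ → g y = (1 + m / (2 * ‖y‖)) ^ 4 • (innerSL ℝ : E3 →L[ℝ] E3 →L[ℝ] ℝ))
    (hm : 0 < m) (hm1 : m ≤ 1) (hmK : m * ∫ s, |η s| ≤ 8) :
    12 * m ≤ avgE η 32 g ∧ avgE η 32 g ≤ 48 * m := by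
  rw [avgE32_eq hη hg]
  have h := abs_profileIntegral_sub_le hη hm.le hm1
  set J := ∫ r, η (r / 32) * (1 + m / (2 * r)) ^ 3
  rw [abs_le] at h
  have hJ1 : 16 ≤ J := by nlinarith
  have hJ2 : J ≤ 48 := by nlinarith
  have hπ1 := Real.pi_gt_three
  have hπ2 := Real.pi_lt_four
  constructor <;> nlinarith [mul_le_mul_of_nonneg_left hJ1 (by positivity : 0 ≤ Real.pi * m),
    mul_le_mul_of_nonneg_left hJ2 (by positivity : 0 ≤ Real.pi * m)]

/-! ## §5 The `C² × C¹` deviation on the annulus -/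

/-- **`DevLE` of a Schwarzschild datum**: with the absolute constant `c` of `exists_devBound`, fields `(g, k)`
which are `((1 + m/2‖y‖)⁴δ, 0)` off `B_{1/4}` have `C² × C¹` deviation at most `c·m` on `{32 ≤ ‖x‖ ≤ 64}`,
`0 ≤ m ≤ 1`. [folklore] -/
theorem devLE_of_agree {c : ℝ}
    (hc : ∀ m : ℝ, 0 ≤ m → m ≤ 1 → ∀ j : ℕ, j ≤ 2 → ∀ x : E3, 32 ≤ ‖x‖ → ‖x‖ ≤ 64 →
      ‖iteratedFDeriv ℝ j
        (fun y : E3 ↦ (1 + m / (2 * ‖y‖)) ^ 4 • (innerSL ℝ : E3 →L[ℝ] E3 →L[ℝ] ℝ) - innerSL ℝ) x‖ ≤ c * m)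
    (hm0 : 0 ≤ m) (hm1 : m ≤ 1)
    (hg : ∀ y : E3, 1 / 4 < ‖y‖ → g y = (1 + m / (2 * ‖y‖)) ^ 4 • (innerSL ℝ : E3 →L[ℝ] E3 →L[ℝ] ℝ))
    (hk : ∀ y : E3, 1 / 4 < ‖y‖ → k y = 0) :
    DevLE g k 32 64 (c * m) := by
  intro x hx1 hx2
  have hx' : 1 / 4 < ‖x‖ := by linarith
  have hcm : 0 ≤ c * m := by
    have := (norm_nonneg _).trans (hc m hm0 hm1 0 (by norm_num) x hx1 hx2)
    exact this
  constructor
  · intro j hj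
    have hge : (fun y ↦ g y - (innerSL ℝ : E3 →L[ℝ] E3 →L[ℝ] ℝ)) =ᶠ[𝓝 x]
        fun y : E3 ↦ (1 + m / (2 * ‖y‖)) ^ 4 • (innerSL ℝ : E3 →L[ℝ] E3 →L[ℝ] ℝ) - innerSL ℝ := by
      filter_upwards [eventuallyEq_schw hg hx'] with y hy
      rw [hy]
    rw [(hge.iteratedFDeriv ℝ j).eq_of_nhds]
    exact hc m hm0 hm1 j hj x hx1 hx2
  · intro j hj
    rw [((schwOut_eventuallyEq_zero hk hx').iteratedFDeriv ℝ j).eq_of_nhds, iteratedFDeriv_fun_zero]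
    simpa using hcm

/-! ## Anchor -/

/-- **Anchor of this helper file** (registered sub-goal `schwOutSiteAux2_anchor` of item 10051): the averaged
linear momentum on `A_32` of a field vanishing off `B_{1/4}` is `0` (`avgP32_eq_zero`). -/
theorem schwOutSiteAux2_anchor : ∀ (η : ℝ → ℝ) (k : E3 → E3 →L[ℝ] E3 →L[ℝ] ℝ) (i : Fin 3),
    IsBump η → (∀ y : E3, 1 / 4 < ‖y‖ → k y = 0) → avgP η 32 k i = 0 :=
  fun _ _ i hη hk ↦ avgP32_eq_zero hη hk i

end Summit.FinalStateConjecture.FinalStateConjecture.Theorems.SwallowTheDatum.UniversalWitnessFamily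

end
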